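import Literature.MathematicalPhysics.QuantumFieldTheory.Balaban1983to89.B8Eq151V2Divergence

/-!
# `Balaban1983to89.B8Eq186AdCommutator` — B8 Sect. D (1.86)–(1.87): the backward covariant derivative `D^{η*}_μ`
# past the power `(ad_{λ(x)})ⁿ`, the polynomial `P_n` made explicit and bounded, and the kernel certificate of the
# cell objection G-B8-11(b) («first order cancels exactly, second order does not»)

CITATION HEADER (lean-in-tree rule 2026-08-18).  Kernel certificate written by the B08 owner lineage
(`b2b-balaban-b08`, generation 28) of the audit cell `pub-balaban` for

* **B8** = T. Bałaban, *Spaces of regular gauge field configurations on a lattice and gauge fixing conditions*,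
  Commun. Math. Phys. **99** (1985) 75–102 [cite key `Balaban1985RegularSpaces`; printed page = PDF page + 74;
  renders READ AS IMAGES by this unit: `1985-cmp99-regular-spaces-gauge-fixing-p002/p016/p017-x2.png` = printed
  pp. 76, 90, 91],
* with the function `g` of **B7** = T. Bałaban, *Averaging operations for lattice gauge theories*, Commun. Math.
  Phys. **98** (1985) 17–51 = reference [3] of B8 [cite key `Balaban1985Averaging`; printed page = PDF page + 16;
  render READ AS IMAGE: `1985-cmp98-averaging-p007-x2.png` = printed p. 23, (34)–(41)] entering only through the
  size of its Taylor coefficients (HONEST SCOPE (iii)),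

on top of the parent module `B8Eq151V2Divergence` (`adR` = `ad`, `conjR_adR`, `eta_smul_covDeriv`, the transport
identity `covDeriv_eq_neg_conjR_covDerivFwd`, `adR_smul_left_real`) and its parents `B8Eq146AExpansion` (`adR`,
`norm_adR_le`, `covDeriv_smul`), `B8Ineq132` (`covDeriv` = (1.1) `D^{η*}_{U,μ}`, `covDerivFwd` = (1.1) `D^η_{U,μ}`,
`norm_conjR`), `B7Eq78Linearization` (`conjR` = `R(U)X = UXU⁻¹`) and `B7Prop1Explicit` (`Site`, `e`, `U1`).  Nothing
in this module is cited FROM the manuscript as a fact: (1.86), (1.87) enter only as the STATEMENTS of kernel-proved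
theorems over the parents' definitions, `P_n` as OUR explicit definition, and (1.88)–(1.89) only as the subject of
the objection certified in §3–§5 — the ABSOLUTE RULE of the cell (no internally-minted statement enters as a cited
fact; the manuscript under audit is not citable for its own steps).  Both papers are UNDER ADJUDICATION by the
cell; nothing of them is asserted here.

## The printed texts (verbatim, from the renders)

* B8 p. 76 [PDF 2], (1.1): «(D^η_{U,μ}F)(x) = η⁻¹(R(U(x, x + ηe_μ))F(x + ηe_μ) − F(x)),
  (D^{η*}_{U,μ}F)(x) = η⁻¹(R(U(x, x − ηe_μ))F(x − ηe_μ) − F(x)), (1.1) where U is an arbitrary gauge field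
  configuration, and R(U)X = UXU⁻¹ for a unitary matrix U and an arbitrary X.»
* B8 p. 90 [PDF 16], (1.84)–(1.85) and the last paragraph: «(1/iη) log(U₁^{u′⁻¹})_b = R(u′⁻¹(b₋))A_b
  + g(i ad_{λ(b₋)})(Dλ)(b) + η𝔉₂(λ(b₋), (Dλ)(b), A_b), (1.84) where |𝔉₂(λ(b₋), (Dλ)(b), A_b)| ≦ O(1)|A_b||(Dλ)(b)|.
  (1.85)  Now we apply the derivative D* to the expression on the right-hand side of (1.84). ηD* is a bounded
  operator, hence D*η𝔉₁ satisfies the bound (1.85). The operators R(u′⁻¹(b₋)) = e^{−i ad_{λ(b₋)}} and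
  g(i ad_{λ(b₋)}) are given by power series in ad_{λ(b₋)}. Let us» — p. 91 [PDF 17] — «consider for example a term
  (ad_{λ(b₋)})ⁿA_b,
  ηD*_μ(ad_{λ(x)})ⁿA_μ(x) = R(U₀(x, x − ηe_μ))(ad_{λ(x−ηe_μ)})ⁿA_μ(x − ηe_μ) − (ad_{λ(x)})ⁿA_μ(x)
  = (ad_{R(U₀(x,x−ηe_μ))λ(x−ηe_μ)})ⁿR(U₀(x, x − ηe_μ))A_μ(x − ηe_μ) − (ad_{λ(x)})ⁿA_μ(x)
  = (η ad_{(D*_μλ)(x)} + ad_{λ(x)})ⁿ(η(D*_μA_μ)(x) + A_μ(x)) − (ad_{λ(x)})ⁿA_μ(x), (1.86)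
  hence D*_μ(ad_{λ(x)})ⁿA_μ(x) = (ad_{λ(x)})ⁿ(D*_μA_μ)(x) + P_n(λ(x), D*_μλ(x), A_μ(x), A_μ(x − ηe_μ)), (1.87)
  and (D*(1/iη) log U₁^{u′⁻¹})(x) = e^{−i ad_{λ(x)}}(D*A)(x) + g(i ad_{λ(x)})(D*Dλ)(x) + 𝔉₃(λ(x), Dλ, A), (1.88)
  where 𝔉₃ depends on (Dλ)(b), A_b for b ∈ st(x) and satisfies |𝔉₃(λ(x), Dλ, A)| ≦ O(1)|Dλ||A|. (1.89)»
* B7 p. 23 [PDF 7], (34): «g⁻¹(z) = −z/(e^{−z} − 1), g⁻¹(−z) = g⁻¹(z) − z, g⁻¹(z) = 1 + ½z + …», whence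
  `g(z) = (1 − e^{−z})/z = Σ_{n≥0}(−1)ⁿzⁿ/(n + 1)!`; (41): «(1/i) log e^{iX+iY}e^{−iY} = g(−i ad_Y)X + O(|X|²)».

## Dictionary (the `ℤ^d` model of the parent modules; additions of this module in **bold**)

Sites `Site d = Fin d → ℤ` (spacing = the explicit `η`), site functions `λ, F : Site d → 𝔸` and bond fields
`A : Site d → Fin d → 𝔸` (`A y μ = A_μ(y) = A(y, y + ηe_μ)`) over a normed `ℂ`-algebra `𝔸` (print: `M_N(ℂ)`,
operator norm), `U₀ : Site d → Fin d → 𝔸ˣ`; `U₀(x, x − ηe_μ) = U₀(x − ηe_μ, x)⁻¹` ((9) of [3]).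
* `D*_μ = D^{η*}_{U₀,μ}` ↦ `covDeriv η U₀ μ`, `D_μ = D^η_{U₀,μ}` ↦ `covDerivFwd η U₀ μ`, `R(U)` ↦ `conjR U`,
  `ad_X` ↦ `adR X` (`XY − YX`) — all the parents';
* `(ad_a)ⁿ` ↦ **`adPow a n`** `= (adR a)^[n]`; print's operator `η ad_a + ad_b` ↦ the map `Z ↦ η•adR a Z + adR b Z`
  (equal to `adR (η•a + b)`, `eta_adR_add_adR`), its `n`-th power the `n`-th iterate;
* `P_n(λ(x), D*_μλ(x), A_μ(x), A_μ(x − ηe_μ))`, which print never displays, ↦ **`Pn η l a Y n`**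
  `= η⁻¹•(adPow (η•a + l) n Y − adPow l n Y)` at `l = λ(x)`, `a = (D*_μλ)(x)`,
  `Y = R(U₀(x, x − ηe_μ))A_μ(x − ηe_μ) = η(D*_μA_μ)(x) + A_μ(x)` [NOT print — OURS: the unique choice making (1.87)
  the identity (1.86) divided by `η`; it depends on print's four arguments through `λ(x)`, `D*_μλ(x)` and the
  transported `A_μ(x − ηe_μ)`, `|Y| = |A_μ(x − ηe_μ)|` for unitary `U₀`];
* the power series `e^{−i ad_λ} = Σ(−i)ⁿ(ad_λ)ⁿ/n!`, `g(i ad_λ) = Σ iⁿ(−1)ⁿ(ad_λ)ⁿ/(n + 1)!` ↦ their FINITE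
  TRUNCATIONS `Σ_{n<N}c_n(ad_λ)ⁿ` with an arbitrary coefficient sequence `c : ℕ → ℂ`, `|c_n| ≤ 1/n!` (both series
  qualify; `c_2 = −½` resp. `−1/6 ≠ 0`); every bound below is UNIFORM in `N`;
* the `su(2)` witness of the cell's objection G-B8-11 («λ = σ₃ + x_μσ₁») ↦ **`σ₁`, `σ₃`** `∈ M₂(ℂ)` with Mathlib's
  `ℓ²`-operator norm (`Matrix.Norms.L2Operator`), **`lamW x = σ₃ + x•σ₁`** on `ℤ¹`, **`U₀W ≡ 1`**, `η = 1`.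

## What is certified (kernel, `sorry`-free; axioms `propext` / `Classical.choice` / `Quot.sound`)

§1–§2 [folklore] the algebra of `(ad_a)ⁿ` in a normed ring: additivity, `R(u)(ad_a)ⁿY = (ad_{R(u)a})ⁿR(u)Y`
(`conjR_adPow` — the second equality of (1.86)), `|(ad_a)ⁿY| ≤ (2|a|)ⁿ|Y|`, the telescoping difference bound
`|(ad_a)ⁿY − (ad_b)ⁿY| ≤ ((2|a − b| + 2|b|)ⁿ − (2|b|)ⁿ)|Y| ≤ n·2|a − b|(2|a − b| + 2|b|)ⁿ⁻¹|Y|`, real/complex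
homogeneity, and `(η ad_a + ad_b)ⁿ = (ad_{ηa+b})ⁿ` (the third equality of (1.86)).  §3 **`P_n` EXPLICIT AND
BOUNDED**: `P_0 = 0`, `P_1(l, a, Y) = [a, Y]` (so (1.87) at `n = 1` is the lattice Leibniz rule `covDeriv_adR`),
`|P_n(l, a, Y)| ≤ 2n|a|(2|η||a| + 2|l|)ⁿ⁻¹|Y|` (`norm_Pn_le`) and, summed against `|c_n| ≤ 1/n!`,
`Σ_{n<N}|c_nP_n| ≤ 2|a|e^{2|η||a| + 2|l|}|Y|` (`sum_norm_Pn_le`) — the explicit first-order-in-`D*λ`-times-`|A|`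
constant behind «|𝔉₃| ≦ O(1)|Dλ||A|» for the `e^{−i ad_λ}A` part; ON `Y = −a` (the `g(i ad_λ)Dλ` part):
`P_{n+1}(l, a, −a) = P_n(l, a, [a, l])` (`Pn_neg_succ`), hence **`P_1(l, a, −a) = 0` EXACTLY** (`Pn_neg_one`, every
ring, every `η`), **`P_2(l, a, −a) = [a, [a, l]]`** (`Pn_neg_two`), `|P_{n+1}(l, a, −a)| ≤ 4n|l||a|²(2|η||a| + 2|l|)ⁿ⁻¹`
and `Σ_{n<N}|c_nP_n(l, a, −a)| ≤ 4|l||a|²e^{2|η||a| + 2|l|}` (`sum_norm_Pn_neg_le`) — SECOND ORDER IN `a = D*λ`, the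
REPAIR shape `O(1)|λ||Dλ|²` of G-B8-11; and the leading-order theorem `truncated_remainder_ne_zero`: for
`|c_n| ≤ 1/n!`, `N ≥ 3`, `0 < t ≤ 1` and `4|l||a|²e^{2|η||a|+2|l|}·t < |c_2||[a, [a, l]]|`,
`Σ_{n<N}c_nP_n(tl, ta, −ta) ≠ 0`.  §4 **(1.86) AND (1.87) ON THE LATTICE**, for every `U₀`, `λ`, `F`, `n`, `x`,
`η ≠ 0`, in every normed `ℂ`-algebra: the three displayed equalities of (1.86) one by one (`eq186_first`,
`eq186_second`, `eq186_third`) and chained (`eq186`); **(1.87)** with our `P_n` (`eq187`, `eq187'`), summed against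
coefficients (`eq187_sum`, with `covDeriv_sum_smul`) and over directions (`eq187_div`); the lattice bound
`|P_n| ≤ 2n|D*_μλ(x)|(2η|D*_μλ(x)| + 2|λ(x)|)ⁿ⁻¹|A_μ(x − ηe_μ)|` for `U₀(x − ηe_μ, x) ∈ U1 ⊇ U(N)`
(`norm_Pn_lattice_le`, `norm_sum_Pn_lattice_le`); FOR `F = D_μλ`: `R(U₀(x, x − ηe_μ))(D_μλ)(x − ηe_μ) = −(D*_μλ)(x)`
(`conjR_covDerivFwd_shift`, the parent's transport identity), so **`D*_μ[λ, D_μλ](x) = [λ(x), (D*_μD_μλ)(x)]` with NO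
remainder** (`covDeriv_adR_covDerivFwd` — G-B8-11(b) «first order cancels EXACTLY») and
**`D*_μ(ad_λ)²(D_μλ)(x) = (ad_{λ(x)})²(D*_μD_μλ)(x) + [a, [a, λ(x)]]`**, `a = (D*_μλ)(x)`
(`covDeriv_adPow_two_covDerivFwd` — the `A`-free second-order term), with `|P_{n+1}| ≤ 4n|λ(x)||a|²(2η|a| + 2|λ(x)|)ⁿ⁻¹`
(`norm_Pn_covDerivFwd_le`, no hypothesis on `U₀`).  §5 **THE WITNESS** (kernel replacement of the cell numerics
N-B8-3 (3c)/(3d), kit job j038525): `[σ₁, [σ₁, σ₃]] = 4σ₃ ≠ 0` in `M₂(ℂ)`; on `ℤ¹` with `U₀ ≡ 1`, `η = 1`,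
`λ(x) = σ₃ + xσ₁`: `(D*_0λ)(x) = −σ₁` and `D*_0(ad_λ)²(D_0λ)(x) − (ad_{λ(x)})²(D*_0D_0λ)(x) = 4σ₃ ≠ 0`
(`witness_second_order`, `witness_second_order_ne_zero`); and **`G_B8_11b_witness`**: for EVERY coefficient sequence
with `|c_n| ≤ 1/n!`, `c_2 ≠ 0` there is `t₀ > 0` such that for all `0 < t < t₀` and all `N ≥ 3`, on `λ_t = tλ`,
`D*_0[Σ_{n<N}c_n(ad_{λ_t})ⁿD_0λ_t](0) − Σ_{n<N}c_n(ad_{λ_t(0)})ⁿ(D*_0D_0λ_t)(0) ≠ 0` — the `A`-free part of the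
remainder of (1.88) does not vanish, whereas the printed bound (1.89) is `0` at `A = 0`.

## HONEST SCOPE — what is NOT claimed

(i) `P_n` is OURS (print displays none); any other polynomial making (1.87) true differs from ours by `0`, since
(1.87) determines `P_n` as `D*_μ(ad_λ)ⁿA_μ − (ad_{λ(x)})ⁿD*_μA_μ` — so the certified statements about «the
remainder of (1.87)» do not depend on the choice.  (ii) THE OBJECTION IS TO (1.89) READ LITERALLY, per direction
`μ` and for the two displayed series: 𝔉₃ of (1.88) is, by (1.84) and (1.87), `Σ_μΣ_nc_nP_n[A_μ] + Σ_μΣ_ng_niⁿP_n[D_μλ]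
+ D*η𝔉₂`; the first group obeys the printed shape `O(1)|Dλ||A|` (certified, explicit constant `2e^{2η|D*λ|+2|λ|}` per
`μ`, uniformly in the truncation), the second is `A`-free, `O(1)|λ||D*λ|²` (certified) and generically non-zero
(certified on the witness, for every truncation `N ≥ 3` and small amplitude `t`) — the cell's REPAIR
`|𝔉₃| ≤ O(1)(|A||Dλ| + |λ||Dλ|²)` (GAPS G-B8-11) is what the kernel supports; part (a) of G-B8-11 (the cubic BCH term
`𝔉₁` of (1.82)–(1.83), also `A`-free) is NOT treated here.  (iii) The power series themselves (`e^{−i ad_λ}`,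
`g(i ad_λ)` as operators, their convergence, B7 (32)–(41)) are NOT formalised: only finite truncations with
`|c_n| ≤ 1/n!` appear, and `g` enters only through `|(−1)ⁿ/(n + 1)!| ≤ 1/n!`, `g_2 = 1/6 ≠ 0` (hypotheses `hc`, `hc2`
to be discharged by the reader for the series at hand); passing to `N → ∞` in the uniform bounds is not done here.
(iv) `D*` on bond functions is read as `Σ_μD*_μA_μ` in `eq187_div` only (our reading; (1.1)–(1.2) display the
components and the plaquette divergence); every other statement is per direction `μ`, exactly as (1.86)–(1.87).
(v) The lattice is `ℤ^d`, not the torus `T_η`/the domains `Ω_j` — immaterial here: (1.86)–(1.87) are pointwise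
identities involving `x` and `x − ηe_μ` only.  (vi) The witness lives in `M₂(ℂ) ⊋ su(2)`; its `λ(x) = σ₃ + xσ₁` is
Hermitian (as print's `λ = (1/i) log u′`) and `U₀ ≡ 1 ∈ U(2)`; smallness (1.77) «|λ| < α₄» is met near `x = 0` by the
scaling `λ_t = tλ`, `t → 0`, which is exactly the regime of `G_B8_11b_witness` (the objection is local: both sides at
`x = 0` involve `λ` on `st(0)` only).  (vii) Nothing here is progress on the summit `Summit.QuantumFields` — the
value is a kernel section certificate for B8 (1.86)–(1.87) and a kernel form of one located objection to (1.89);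
per the cell's GAPS G-B8-11 the repair costs constants only (Proposition 5 as stated intact).
-/

noncomputable section

open scoped BigOperators Nat
open NormedSpace Finset

namespace Literature.MathematicalPhysics.QuantumFieldTheory.Balaban1983to89.B8Eq186AdCommutator

open B7Prop1Explicit
open B7Eq78Linearization (conjR conjR_apply conjR_one conjR_add conjR_sub conjR_smul conjR_smul_real)
open B8Ineq132 (covDeriv covDerivFwd conjR_conjR one_conjR conjR_sum norm_conjR_le norm_conjR)
open B8Eq146AExpansion (adR norm_adR_le conjR_neg adR_smul_left adR_smul_right adR_smul_right_real adR_neg_left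
  covDeriv_smul)
open B8Eq151V2Divergence (conjR_mul conjR_adR adR_self adR_swap norm_adR_le_of_le eta_smul_covDeriv
  eta_smul_covDerivFwd covDerivFwd_smul adR_smul_left_real covDeriv_eq_neg_conjR_covDerivFwd norm_covDeriv_eq)

-- `Site` alone would resolve to the torus sites of `Setup.lean`; re-export the `ℤ^d` sites of `B7Prop1Explicit`.
export B7Prop1Explicit (Site)

variable {d : ℕ}

/-! ## §1 [folklore] The powers `(ad_a)ⁿ` in a normed ring: linearity, `R(u)`-equivariance, norm and difference bounds -/

section AdPow

variable {𝔸 : Type*} [NormedRing 𝔸]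

/-- `(ad_a)ⁿY` — the `n`-th power of the inner derivation `ad_a = [a, ·]` (the parent's `adR a`) applied to `Y`
(«a term (ad_{λ(b₋)})ⁿA_b», p. 91). [cite: Balaban1985RegularSpaces, (1.86) p.91] -/
def adPow (a : 𝔸) (n : ℕ) (Y : 𝔸) : 𝔸 := (adR a)^[n] Y

/-- `(ad_a)⁰ = id`. [folklore] -/
@[simp] theorem adPow_zero (a Y : 𝔸) : adPow a 0 Y = Y := rfl

/-- `(ad_a)ⁿ⁺¹Y = ad_a((ad_a)ⁿY)`. [folklore] -/
theorem adPow_succ (a : 𝔸) (n : ℕ) (Y : 𝔸) : adPow a (n + 1) Y = adR a (adPow a n Y) :=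
  Function.iterate_succ_apply' (adR a) n Y

/-- `(ad_a)ⁿ⁺¹Y = (ad_a)ⁿ(ad_aY)`. [folklore] -/
theorem adPow_succ' (a : 𝔸) (n : ℕ) (Y : 𝔸) : adPow a (n + 1) Y = adPow a n (adR a Y) :=
  Function.iterate_succ_apply (adR a) n Y

/-- `(ad_a)¹ = ad_a`. [folklore] -/
@[simp] theorem adPow_one (a Y : 𝔸) : adPow a 1 Y = adR a Y := rfl

/-- `ad_a` is additive in its argument. [folklore] -/
theorem adR_add_right (a X Y : 𝔸) : adR a (X + Y) = adR a X + adR a Y := by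
  simp only [adR, mul_add, add_mul]; abel

/-- `ad_a` is subtractive in its argument. [folklore] -/
theorem adR_sub_right (a X Y : 𝔸) : adR a (X - Y) = adR a X - adR a Y := by
  simp only [adR, mul_sub, sub_mul]; abel

/-- `ad_a(−X) = −ad_aX`. [folklore] -/
theorem adR_neg_right (a X : 𝔸) : adR a (-X) = -adR a X := by
  simp only [adR, mul_neg, neg_mul]; abel

/-- `ad_a 0 = 0`. [folklore] -/
@[simp] theorem adR_zero_right (a : 𝔸) : adR a 0 = 0 := by simp [adR]

/-- `ad` is additive in its subscript: `ad_{a + b} = ad_a + ad_b`. [folklore] -/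
theorem adR_add_left (a b X : 𝔸) : adR (a + b) X = adR a X + adR b X := by
  simp only [adR, add_mul, mul_add]; abel

/-- `ad_{a − b} = ad_a − ad_b`. [folklore] -/
theorem adR_sub_left (a b X : 𝔸) : adR (a - b) X = adR a X - adR b X := by
  simp only [adR, sub_mul, mul_sub]; abel

/-- `(ad_a)ⁿ` is additive. [folklore] -/
theorem adPow_add (a : 𝔸) (n : ℕ) (X Y : 𝔸) : adPow a n (X + Y) = adPow a n X + adPow a n Y := by
  induction n with
  | zero => rfl
  | succ n ih => rw [adPow_succ, adPow_succ, adPow_succ, ih, adR_add_right]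

/-- `(ad_a)ⁿ` is subtractive. [folklore] -/
theorem adPow_sub (a : 𝔸) (n : ℕ) (X Y : 𝔸) : adPow a n (X - Y) = adPow a n X - adPow a n Y := by
  induction n with
  | zero => rfl
  | succ n ih => rw [adPow_succ, adPow_succ, adPow_succ, ih, adR_sub_right]

/-- `(ad_a)ⁿ(−Y) = −(ad_a)ⁿY`. [folklore] -/
theorem adPow_neg (a : 𝔸) (n : ℕ) (Y : 𝔸) : adPow a n (-Y) = -adPow a n Y := by
  induction n with
  | zero => rfl
  | succ n ih => rw [adPow_succ, adPow_succ, ih, adR_neg_right]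

/-- `(ad_a)ⁿ0 = 0`. [folklore] -/
@[simp] theorem adPow_zero_right (a : 𝔸) (n : ℕ) : adPow a n 0 = 0 := by
  induction n with
  | zero => rfl
  | succ n ih => rw [adPow_succ, ih, adR_zero_right]

/-- `(ad_a)ⁿ` commutes with finite sums. [folklore] -/
theorem adPow_sum {ι : Type*} (a : 𝔸) (n : ℕ) (s : Finset ι) (f : ι → 𝔸) :
    adPow a n (∑ i ∈ s, f i) = ∑ i ∈ s, adPow a n (f i) := by
  induction s using Finset.cons_induction with
  | empty => simp
  | cons i s hi ih => rw [Finset.sum_cons, Finset.sum_cons, adPow_add, ih]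

/-- `R(u)`-EQUIVARIANCE — the second equality of (1.86): `R(u)(ad_a)ⁿY = (ad_{R(u)a})ⁿR(u)Y` (`R(u)` is an algebra
automorphism, parent's `conjR_adR`). [cite: Balaban1985RegularSpaces, (1.86) p.91 (second equality)] -/
theorem conjR_adPow (u : 𝔸ˣ) (a : 𝔸) (n : ℕ) (Y : 𝔸) :
    conjR u (adPow a n Y) = adPow (conjR u a) n (conjR u Y) := by
  induction n with
  | zero => rfl
  | succ n ih => rw [adPow_succ, adPow_succ, conjR_adR, ih]

/-- `|(ad_a)ⁿY| ≤ (2|a|)ⁿ|Y|` (print, p. 84: «iη ad_{A} = O₁(2·…)»). [folklore] -/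
theorem norm_adPow_le (a : 𝔸) (n : ℕ) (Y : 𝔸) : ‖adPow a n Y‖ ≤ (2 * ‖a‖) ^ n * ‖Y‖ := by
  induction n with
  | zero => simp
  | succ n ih =>
    rw [adPow_succ, pow_succ]
    calc ‖adR a (adPow a n Y)‖ ≤ 2 * ‖a‖ * ‖adPow a n Y‖ := norm_adR_le _ _
      _ ≤ 2 * ‖a‖ * ((2 * ‖a‖) ^ n * ‖Y‖) := by gcongr
      _ = (2 * ‖a‖) ^ n * (2 * ‖a‖) * ‖Y‖ := by ring

/-- THE TELESCOPING STEP: `(ad_a)ⁿ⁺¹Y − (ad_b)ⁿ⁺¹Y = ad_a((ad_a)ⁿY − (ad_b)ⁿY) + ad_{a − b}(ad_b)ⁿY`. [folklore] -/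
theorem adPow_succ_sub_adPow_succ (a b : 𝔸) (n : ℕ) (Y : 𝔸) :
    adPow a (n + 1) Y - adPow b (n + 1) Y
      = adR a (adPow a n Y - adPow b n Y) + adR (a - b) (adPow b n Y) := by
  rw [adPow_succ, adPow_succ, adR_sub_right, adR_sub_left]; abel

/-- DIFFERENCE OF TWO POWERS: `|(ad_a)ⁿY − (ad_b)ⁿY| ≤ ((2|a − b| + 2|b|)ⁿ − (2|b|)ⁿ)|Y|`. [folklore] -/
theorem norm_adPow_sub_adPow_le (a b : 𝔸) (n : ℕ) (Y : 𝔸) :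
    ‖adPow a n Y - adPow b n Y‖ ≤ ((2 * ‖a - b‖ + 2 * ‖b‖) ^ n - (2 * ‖b‖) ^ n) * ‖Y‖ := by
  induction n with
  | zero => simp
  | succ n ih =>
    have ha : 2 * ‖a‖ ≤ 2 * ‖a - b‖ + 2 * ‖b‖ := by
      have := norm_sub_norm_le a b; linarith
    have hpq : (2 * ‖b‖) ^ n ≤ (2 * ‖a - b‖ + 2 * ‖b‖) ^ n :=
      pow_le_pow_left₀ (by positivity) (by linarith [norm_nonneg (a - b)]) n
    rw [adPow_succ_sub_adPow_succ]
    calc ‖adR a (adPow a n Y - adPow b n Y) + adR (a - b) (adPow b n Y)‖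
        ≤ ‖adR a (adPow a n Y - adPow b n Y)‖ + ‖adR (a - b) (adPow b n Y)‖ := norm_add_le _ _
      _ ≤ 2 * ‖a‖ * ‖adPow a n Y - adPow b n Y‖ + 2 * ‖a - b‖ * ‖adPow b n Y‖ :=
          add_le_add (norm_adR_le _ _) (norm_adR_le _ _)
      _ ≤ (2 * ‖a - b‖ + 2 * ‖b‖) * (((2 * ‖a - b‖ + 2 * ‖b‖) ^ n - (2 * ‖b‖) ^ n) * ‖Y‖)
            + 2 * ‖a - b‖ * ((2 * ‖b‖) ^ n * ‖Y‖) := by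
          apply add_le_add
          · exact mul_le_mul ha ih (norm_nonneg _) (by positivity)
          · exact mul_le_mul_of_nonneg_left (norm_adPow_le b n Y) (by positivity)
      _ = ((2 * ‖a - b‖ + 2 * ‖b‖) ^ (n + 1) - (2 * ‖b‖) ^ (n + 1)) * ‖Y‖ := by ring

/-- `pⁿ − qⁿ ≤ n(p − q)pⁿ⁻¹` for `0 ≤ q ≤ p`. [folklore] -/
theorem pow_sub_pow_le_mul (p q : ℝ) (hq : 0 ≤ q) (hqp : q ≤ p) (n : ℕ) :
    p ^ n - q ^ n ≤ n * (p - q) * p ^ (n - 1) := by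
  have hp : 0 ≤ p := hq.trans hqp
  induction n with
  | zero => simp
  | succ n ih =>
    cases n with
    | zero => simp
    | succ m =>
      simp only [Nat.add_sub_cancel] at ih ⊢
      have hqm : q ^ (m + 1) ≤ p ^ (m + 1) := pow_le_pow_left₀ hq hqp _
      have e1 : p ^ (m + 1 + 1) - q ^ (m + 1 + 1) = p * (p ^ (m + 1) - q ^ (m + 1)) + (p - q) * q ^ (m + 1) := by
        ring
      rw [e1]
      calc p * (p ^ (m + 1) - q ^ (m + 1)) + (p - q) * q ^ (m + 1)
          ≤ p * (((m + 1 : ℕ) : ℝ) * (p - q) * p ^ m) + (p - q) * p ^ (m + 1) :=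
            add_le_add (mul_le_mul_of_nonneg_left ih hp) (mul_le_mul_of_nonneg_left hqm (sub_nonneg.2 hqp))
        _ = ((m + 1 + 1 : ℕ) : ℝ) * (p - q) * p ^ (m + 1) := by push_cast; ring

/-- DIFFERENCE OF TWO POWERS, mean-value form: `|(ad_a)ⁿY − (ad_b)ⁿY| ≤ n·2|a − b|·(2|a − b| + 2|b|)ⁿ⁻¹|Y|` —
first order in `a − b`. [folklore] -/
theorem norm_adPow_sub_adPow_le' (a b : 𝔸) (n : ℕ) (Y : 𝔸) :
    ‖adPow a n Y - adPow b n Y‖ ≤ n * (2 * ‖a - b‖) * (2 * ‖a - b‖ + 2 * ‖b‖) ^ (n - 1) * ‖Y‖ := by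
  refine (norm_adPow_sub_adPow_le a b n Y).trans (mul_le_mul_of_nonneg_right ?_ (norm_nonneg _))
  have h := pow_sub_pow_le_mul (2 * ‖a - b‖ + 2 * ‖b‖) (2 * ‖b‖) (by positivity)
    (le_add_of_nonneg_left (by positivity)) n
  rwa [add_sub_cancel_right] at h

end AdPow

/-! ## §2 [folklore] Scalars: `(ad_a)ⁿ(cY) = c(ad_a)ⁿY`, `(ad_{ca})ⁿ = cⁿ(ad_a)ⁿ`, and print's operator
`η ad_a + ad_b = ad_{ηa + b}` -/

section Scalars

variable {𝔸 : Type*} [NormedRing 𝔸] [NormedAlgebra ℂ 𝔸]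

/-- `(ad_a)ⁿ(cY) = c·(ad_a)ⁿY`, real scalar. [folklore] -/
theorem adPow_smul_right (a : 𝔸) (n : ℕ) (c : ℝ) (Y : 𝔸) : adPow a n (c • Y) = c • adPow a n Y := by
  induction n with
  | zero => rfl
  | succ n ih => rw [adPow_succ, adPow_succ, ih, adR_smul_right_real]

/-- `(ad_a)ⁿ(cY) = c·(ad_a)ⁿY`, complex scalar. [folklore] -/
theorem adPow_smul_right_complex (a : 𝔸) (n : ℕ) (c : ℂ) (Y : 𝔸) : adPow a n (c • Y) = c • adPow a n Y := by
  induction n with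
  | zero => rfl
  | succ n ih => rw [adPow_succ, adPow_succ, ih, adR_smul_right]

/-- HOMOGENEITY: `(ad_{ca})ⁿY = cⁿ(ad_a)ⁿY`, real scalar. [folklore] -/
theorem adPow_smul_left (c : ℝ) (a : 𝔸) (n : ℕ) (Y : 𝔸) : adPow (c • a) n Y = c ^ n • adPow a n Y := by
  induction n with
  | zero => simp
  | succ n ih =>
    rw [adPow_succ, adPow_succ, ih, adR_smul_right_real, adR_smul_left_real, smul_smul, pow_succ, mul_comm]

/-- Print's operator `η ad_a + ad_b` IS `ad_{ηa + b}` (`ad` is linear in its subscript):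
`η ad_aY + ad_bY = ad_{ηa + b}Y`. [cite: Balaban1985RegularSpaces, (1.86) p.91 (third equality)] -/
theorem eta_adR_add_adR (η : ℝ) (a b Y : 𝔸) : η • adR a Y + adR b Y = adR (η • a + b) Y := by
  rw [adR_add_left, adR_smul_left_real]

/-- … and so are its powers: `(η ad_a + ad_b)ⁿY = (ad_{ηa + b})ⁿY`.
[cite: Balaban1985RegularSpaces, (1.86) p.91 (third equality)] -/
theorem iterate_eta_adR_add_adR (η : ℝ) (a b : 𝔸) (n : ℕ) (Y : 𝔸) :
    (fun Z => η • adR a Z + adR b Z)^[n] Y = adPow (η • a + b) n Y := by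
  induction n with
  | zero => rfl
  | succ n ih => rw [Function.iterate_succ_apply', ih, adPow_succ, eta_adR_add_adR]

end Scalars

/-! ## §3 The polynomial `P_n` of (1.87), EXPLICIT [NOT print — ours], its bound, and its values on `Y = −a` -/

section Pn

variable {𝔸 : Type*} [NormedRing 𝔸] [NormedAlgebra ℂ 𝔸]

/-- **`P_n` OF (1.87), MADE EXPLICIT** [NOT print — ours: print only names `P_n(λ(x), D*_μλ(x), A_μ(x), A_μ(x − ηe_μ))`
and never displays it].  Reading (1.86): with `l = λ(x)`, `a = (D*_μλ)(x)`, and `Y = R(U₀(x, x − ηe_μ))A_μ(x − ηe_μ)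
= η(D*_μA_μ)(x) + A_μ(x)` (the transported value; `|Y| = |A_μ(x − ηe_μ)|` for unitary `U₀`),
`P_n(l, a, Y) = η⁻¹[(ad_{ηa + l})ⁿ − (ad_l)ⁿ]Y`, so that (1.87) holds EXACTLY (`eq187`).
[cite: Balaban1985RegularSpaces, (1.87) p.91] -/
def Pn (η : ℝ) (l a Y : 𝔸) (n : ℕ) : 𝔸 := η⁻¹ • (adPow (η • a + l) n Y - adPow l n Y)

/-- `P_0 = 0`. [folklore] -/
@[simp] theorem Pn_zero (η : ℝ) (l a Y : 𝔸) : Pn η l a Y 0 = 0 := by simp [Pn]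

/-- `ηP_n = [(ad_{ηa + l})ⁿ − (ad_l)ⁿ]Y`, `η ≠ 0`. [folklore] -/
theorem eta_smul_Pn {η : ℝ} (hη : η ≠ 0) (l a Y : 𝔸) (n : ℕ) :
    η • Pn η l a Y n = adPow (η • a + l) n Y - adPow l n Y := by
  rw [Pn, smul_smul, mul_inv_cancel₀ hη, one_smul]

/-- `P_1(l, a, Y) = ad_aY = [a, Y]` (`η ≠ 0`): at `n = 1` (1.87) is the lattice Leibniz rule
`D*_μ[λ, A_μ](x) = [λ(x), (D*_μA_μ)(x)] + [(D*_μλ)(x), R(U₀(x, x − ηe_μ))A_μ(x − ηe_μ)]`. [folklore] -/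
theorem Pn_one {η : ℝ} (hη : η ≠ 0) (l a Y : 𝔸) : Pn η l a Y 1 = adR a Y := by
  simp only [Pn, adPow_one, adR_add_left, adR_smul_left_real, add_sub_cancel_right, smul_smul, inv_mul_cancel₀ hη,
    one_smul]

/-- **THE BOUND ON `P_n`** (the first-order-in-`D*λ` shape behind (1.89) / (1.85)): for `η ≠ 0`,
`|P_n(l, a, Y)| ≤ 2n|a|(2|η||a| + 2|l|)ⁿ⁻¹|Y|`. [NOT print — ours]
[cite: Balaban1985RegularSpaces, (1.87)-(1.89) p.91] -/
theorem norm_Pn_le {η : ℝ} (hη : η ≠ 0) (l a Y : 𝔸) (n : ℕ) :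
    ‖Pn η l a Y n‖ ≤ 2 * n * ‖a‖ * (2 * (|η| * ‖a‖) + 2 * ‖l‖) ^ (n - 1) * ‖Y‖ := by
  have h := norm_adPow_sub_adPow_le' (η • a + l) l n Y
  rw [add_sub_cancel_right, norm_smul, Real.norm_eq_abs] at h
  rw [Pn, norm_smul, norm_inv, Real.norm_eq_abs]
  have hη' : |η| ≠ 0 := abs_ne_zero.2 hη
  calc |η|⁻¹ * ‖adPow (η • a + l) n Y - adPow l n Y‖
      ≤ |η|⁻¹ * (n * (2 * (|η| * ‖a‖)) * (2 * (|η| * ‖a‖) + 2 * ‖l‖) ^ (n - 1) * ‖Y‖) := by gcongr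
    _ = |η|⁻¹ * |η| * (2 * n * ‖a‖ * (2 * (|η| * ‖a‖) + 2 * ‖l‖) ^ (n - 1) * ‖Y‖) := by ring
    _ = 2 * n * ‖a‖ * (2 * (|η| * ‖a‖) + 2 * ‖l‖) ^ (n - 1) * ‖Y‖ := by rw [inv_mul_cancel₀ hη', one_mul]

/-- HOMOGENEITY: `P_n(tl, ta, tY) = tⁿ⁺¹P_n(l, a, Y)` (degree `n + 1`). [folklore] -/
theorem Pn_smul (η t : ℝ) (l a Y : 𝔸) (n : ℕ) :
    Pn η (t • l) (t • a) (t • Y) n = t ^ (n + 1) • Pn η l a Y n := by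
  have hW : η • (t • a) + t • l = t • (η • a + l) := by rw [smul_add, smul_comm]
  rw [Pn, Pn, hW, adPow_smul_left, adPow_smul_left, adPow_smul_right, adPow_smul_right, smul_smul, smul_smul,
    ← smul_sub, smul_comm η⁻¹, ← pow_succ]

/-! ### The case `Y = −a` (the `g(i ad_λ)(Dλ)` term of (1.84): `R(U₀(x, x − ηe_μ))(D_μλ)(x − ηe_μ) = −(D*_μλ)(x)`) -/

/-- `ad_{ηa + l}(−a) = [a, l]`: the `ηa` part of the subscript annihilates `−a`. [folklore] -/
theorem adR_eta_smul_add_neg (η : ℝ) (l a : 𝔸) : adR (η • a + l) (-a) = adR a l := by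
  rw [adR_add_left, adR_smul_left_real, adR_neg_right, adR_neg_right, adR_self, neg_zero, smul_zero, zero_add,
    adR_swap a l, neg_neg]

omit [NormedAlgebra ℂ 𝔸] in
/-- `ad_l(−a) = [a, l]`. [folklore] -/
theorem adR_neg_eq_swap (l a : 𝔸) : adR l (-a) = adR a l := by
  rw [adR_neg_right, adR_swap a l, neg_neg]

/-- THE SHIFT: `P_{n+1}(l, a, −a) = P_n(l, a, [a, l])` — both operators send `−a` to the same `[a, l]` first.
[folklore] -/
theorem Pn_neg_succ (η : ℝ) (l a : 𝔸) (n : ℕ) : Pn η l a (-a) (n + 1) = Pn η l a (adR a l) n := by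
  rw [Pn, Pn, adPow_succ', adPow_succ', adR_eta_smul_add_neg, adR_neg_eq_swap]

/-- **FIRST ORDER CANCELS EXACTLY**: `P_1(l, a, −a) = 0` for every `η`, `l`, `a`, in every ring. [folklore] -/
theorem Pn_neg_one (η : ℝ) (l a : 𝔸) : Pn η l a (-a) 1 = 0 :=
  (Pn_neg_succ η l a 0).trans (Pn_zero η l a _)

/-- **SECOND ORDER DOES NOT**: `P_2(l, a, −a) = [a, [a, l]]` (`η ≠ 0`). [folklore] -/
theorem Pn_neg_two {η : ℝ} (hη : η ≠ 0) (l a : 𝔸) : Pn η l a (-a) 2 = adR a (adR a l) :=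
  (Pn_neg_succ η l a 1).trans (Pn_one hη l a _)

/-- THE `Y = −a` BOUND, SECOND ORDER IN `a`: `|P_{n+1}(l, a, −a)| ≤ 4n|l||a|²(2|η||a| + 2|l|)ⁿ⁻¹` (`η ≠ 0`).
[NOT print — ours] [cite: Balaban1985RegularSpaces, (1.87)-(1.89) p.91] -/
theorem norm_Pn_neg_le {η : ℝ} (hη : η ≠ 0) (l a : 𝔸) (n : ℕ) :
    ‖Pn η l a (-a) (n + 1)‖ ≤ 4 * n * ‖l‖ * ‖a‖ ^ 2 * (2 * (|η| * ‖a‖) + 2 * ‖l‖) ^ (n - 1) := by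
  rw [Pn_neg_succ]
  refine (norm_Pn_le hη l a (adR a l) n).trans ?_
  calc 2 * n * ‖a‖ * (2 * (|η| * ‖a‖) + 2 * ‖l‖) ^ (n - 1) * ‖adR a l‖
      ≤ 2 * n * ‖a‖ * (2 * (|η| * ‖a‖) + 2 * ‖l‖) ^ (n - 1) * (2 * ‖a‖ * ‖l‖) := by
        gcongr; exact norm_adR_le a l
    _ = 4 * n * ‖l‖ * ‖a‖ ^ 2 * (2 * (|η| * ‖a‖) + 2 * ‖l‖) ^ (n - 1) := by ring

/-! ### Finite truncations of the power series `e^{−i ad_λ}`, `g(i ad_λ)`: majorants uniform in the truncation -/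

/-- `Σ_{n<N} n pⁿ⁻¹/n! ≤ eᵖ` (`p ≥ 0`). [folklore] -/
theorem sum_mul_pow_div_factorial_le_exp {p : ℝ} (hp : 0 ≤ p) (N : ℕ) :
    ∑ n ∈ range N, (n : ℝ) * p ^ (n - 1) / n ! ≤ Real.exp p := by
  cases N with
  | zero => simpa using (Real.exp_pos p).le
  | succ M =>
    rw [Finset.sum_range_succ']
    have key : ∀ m : ℕ, ((m + 1 : ℕ) : ℝ) * p ^ (m + 1 - 1) / ((m + 1)! : ℝ) = p ^ m / (m ! : ℝ) := by
      intro m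
      rw [Nat.add_sub_cancel, Nat.factorial_succ]
      have hm : ((m + 1 : ℕ) : ℝ) ≠ 0 := by positivity
      have hf : ((m ! : ℕ) : ℝ) ≠ 0 := by positivity
      push_cast
      field_simp
    simp only [key, Nat.cast_zero, zero_mul, zero_div, add_zero]
    exact Real.sum_le_exp_of_nonneg hp M

/-- **THE MAJORANT, GENERAL `Y`** (the `e^{−i ad_{λ(x)}}(D*A)(x)` part of (1.88)): for coefficients `|c_n| ≤ 1/n!`
(both `e^{−iz} = Σ(−i)ⁿzⁿ/n!` and `g(z) = (1 − e^{−z})/z = Σ(−1)ⁿzⁿ/(n + 1)!` of (34) of [3] qualify, evaluated at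
`z = i ad_λ`): `Σ_{n<N}|c_nP_n(l, a, Y)| ≤ 2|a|e^{2|η||a| + 2|l|}|Y|`, uniformly in `N` — the explicit `O(1)|D*λ||A|` of
(1.89) for this part. [NOT print — ours]
[cite: Balaban1985RegularSpaces, (1.88)-(1.89) p.91] -/
theorem sum_norm_Pn_le {η : ℝ} (hη : η ≠ 0) {c : ℕ → ℂ} (hc : ∀ n, ‖c n‖ ≤ 1 / n !) (l a Y : 𝔸) (N : ℕ) :
    ∑ n ∈ range N, ‖c n • Pn η l a Y n‖ ≤ 2 * ‖a‖ * Real.exp (2 * (|η| * ‖a‖) + 2 * ‖l‖) * ‖Y‖ := by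
  set p := 2 * (|η| * ‖a‖) + 2 * ‖l‖ with hp_def
  have hp : 0 ≤ p := by positivity
  calc ∑ n ∈ range N, ‖c n • Pn η l a Y n‖
      ≤ ∑ n ∈ range N, 1 / (n ! : ℝ) * (2 * n * ‖a‖ * p ^ (n - 1) * ‖Y‖) := by
        refine Finset.sum_le_sum fun n _ => ?_
        rw [norm_smul]
        exact mul_le_mul (hc n) (norm_Pn_le hη l a Y n) (norm_nonneg _) (by positivity)
    _ = 2 * ‖a‖ * (∑ n ∈ range N, (n : ℝ) * p ^ (n - 1) / n !) * ‖Y‖ := by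
        rw [Finset.mul_sum, Finset.sum_mul]
        exact Finset.sum_congr rfl fun n _ => by ring
    _ ≤ 2 * ‖a‖ * Real.exp p * ‖Y‖ := by
        gcongr; exact sum_mul_pow_div_factorial_le_exp hp N

/-- The same for the norm of the sum. [NOT print — ours] [cite: Balaban1985RegularSpaces, (1.88)-(1.89) p.91] -/
theorem norm_sum_Pn_le {η : ℝ} (hη : η ≠ 0) {c : ℕ → ℂ} (hc : ∀ n, ‖c n‖ ≤ 1 / n !) (l a Y : 𝔸) (N : ℕ) :
    ‖∑ n ∈ range N, c n • Pn η l a Y n‖ ≤ 2 * ‖a‖ * Real.exp (2 * (|η| * ‖a‖) + 2 * ‖l‖) * ‖Y‖ :=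
  (norm_sum_le _ _).trans (sum_norm_Pn_le hη hc l a Y N)

/-- **THE MAJORANT, `Y = −a`** (the `g(i ad_{λ(x)})(D*Dλ)(x)` part of (1.88)): the `A`-FREE remainder is SECOND ORDER
in `a = D*λ`: `Σ_{n<N}|c_nP_n(l, a, −a)| ≤ 4|l||a|²e^{2|η||a| + 2|l|}`, uniformly in `N` — the REPAIR shape
`O(1)|λ||Dλ|²` of cell objection G-B8-11, NOT the printed `O(1)|Dλ||A|` of (1.89).
[NOT print — ours]
[cite: Balaban1985RegularSpaces, (1.88)-(1.89) p.91] -/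
theorem sum_norm_Pn_neg_le {η : ℝ} (hη : η ≠ 0) {c : ℕ → ℂ} (hc : ∀ n, ‖c n‖ ≤ 1 / n !) (l a : 𝔸) (N : ℕ) :
    ∑ n ∈ range N, ‖c n • Pn η l a (-a) n‖ ≤ 4 * ‖l‖ * ‖a‖ ^ 2 * Real.exp (2 * (|η| * ‖a‖) + 2 * ‖l‖) := by
  cases N with
  | zero => simp; positivity
  | succ M =>
    rw [Finset.sum_range_succ']
    simp only [Pn_zero, smul_zero, norm_zero, add_zero, Pn_neg_succ]
    have hc' : ∀ m, ‖c (m + 1)‖ ≤ 1 / m ! := fun m => (hc (m + 1)).trans (by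
      rw [Nat.factorial_succ]
      have hf : (0 : ℝ) < m ! := by positivity
      refine one_div_le_one_div_of_le hf ?_
      push_cast
      nlinarith)
    refine (sum_norm_Pn_le hη hc' l a (adR a l) M).trans ?_
    calc 2 * ‖a‖ * Real.exp (2 * (|η| * ‖a‖) + 2 * ‖l‖) * ‖adR a l‖
        ≤ 2 * ‖a‖ * Real.exp (2 * (|η| * ‖a‖) + 2 * ‖l‖) * (2 * ‖a‖ * ‖l‖) := by
          gcongr; exact norm_adR_le a l
      _ = 4 * ‖l‖ * ‖a‖ ^ 2 * Real.exp (2 * (|η| * ‖a‖) + 2 * ‖l‖) := by ring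

/-! ### Leading order: the `A`-free remainder does NOT vanish -/

/-- [folklore] LEADING-ORDER NON-VANISHING: if `|S − t³v| ≤ Kt⁴`, `0 < t` and `Kt < |v|`, then `S ≠ 0`. -/
theorem ne_zero_of_leading_order {E : Type*} [SeminormedAddCommGroup E] [NormedSpace ℝ E] {S v : E} {K t : ℝ}
    (ht : 0 < t) (htK : K * t < ‖v‖) (hS : ‖S - t ^ 3 • v‖ ≤ K * t ^ 4) : S ≠ 0 := by
  intro hS0
  rw [hS0, zero_sub, norm_neg, norm_smul, Real.norm_eq_abs, abs_of_pos (pow_pos ht 3)] at hS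
  have h3 : 0 < t ^ 3 := pow_pos ht 3
  have h' : t ^ 3 * ‖v‖ ≤ t ^ 3 * (K * t) := by linarith
  have := le_of_mul_le_mul_left h' h3
  linarith

/-- **THE `A`-FREE REMAINDER IS NOT ZERO** (kernel form of «second order does not cancel»): for coefficients
`|c_n| ≤ 1/n!`, every truncation order `N ≥ 3` and every `0 < t ≤ 1` with
`4|l||a|²e^{2|η||a| + 2|l|}·t < |c_2|·|[a, [a, l]]|`, the remainder `Σ_{n<N}c_nP_n(tl, ta, −ta) ≠ 0`. So whenever
`[a, [a, l]] ≠ 0` and `c_2 ≠ 0` (for `g`: `c_2 = i²/3! = −1/6`) it is non-zero for all small `t` — it is NOT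
bounded by `O(1)|Dλ||A|`, which vanishes at `A = 0`. [NOT print — ours]
[cite: Balaban1985RegularSpaces, (1.88)-(1.89) p.91] -/
theorem truncated_remainder_ne_zero {η : ℝ} (hη : η ≠ 0) {c : ℕ → ℂ} (hc : ∀ n, ‖c n‖ ≤ 1 / n !) (l a : 𝔸)
    {t : ℝ} (ht0 : 0 < t) (ht1 : t ≤ 1)
    (htK : 4 * ‖l‖ * ‖a‖ ^ 2 * Real.exp (2 * (|η| * ‖a‖) + 2 * ‖l‖) * t < ‖c 2‖ * ‖adR a (adR a l)‖)
    {N : ℕ} (hN : 3 ≤ N) :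
    ∑ n ∈ range N, c n • Pn η (t • l) (t • a) (-(t • a)) n ≠ 0 := by
  set K := 4 * ‖l‖ * ‖a‖ ^ 2 * Real.exp (2 * (|η| * ‖a‖) + 2 * ‖l‖) with hK
  have hom : ∀ n, c n • Pn η (t • l) (t • a) (-(t • a)) n = t ^ (n + 1) • (c n • Pn η l a (-a) n) := by
    intro n
    rw [← smul_neg, Pn_smul, smul_comm]
  simp_rw [hom]
  have h2 : 2 ∈ range N := Finset.mem_range.2 (by omega)
  refine ne_zero_of_leading_order (v := c 2 • adR a (adR a l)) (K := K) ht0 (by rwa [norm_smul]) ?_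
  rw [← Finset.sum_erase_add _ _ h2, Pn_neg_two hη, add_sub_cancel_right]
  calc ‖∑ n ∈ (range N).erase 2, t ^ (n + 1) • (c n • Pn η l a (-a) n)‖
      ≤ ∑ n ∈ (range N).erase 2, ‖t ^ (n + 1) • (c n • Pn η l a (-a) n)‖ := norm_sum_le _ _
    _ ≤ ∑ n ∈ (range N).erase 2, t ^ 4 * ‖c n • Pn η l a (-a) n‖ := by
        refine Finset.sum_le_sum fun n hn => ?_
        rw [norm_smul, Real.norm_eq_abs, abs_of_nonneg (pow_nonneg ht0.le _)]
        have hn2 : n ≠ 2 := (Finset.mem_erase.1 hn).1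
        rcases Nat.lt_or_ge n 2 with hlt | hge
        · interval_cases n
          · simp
          · simp [Pn_neg_one]
        · have h3n : 4 ≤ n + 1 := by omega
          exact mul_le_mul_of_nonneg_right (pow_le_pow_of_le_one ht0.le ht1 h3n) (norm_nonneg _)
    _ ≤ ∑ n ∈ range N, t ^ 4 * ‖c n • Pn η l a (-a) n‖ :=
        Finset.sum_le_sum_of_subset_of_nonneg (Finset.erase_subset _ _) fun n _ _ => by positivity
    _ = t ^ 4 * ∑ n ∈ range N, ‖c n • Pn η l a (-a) n‖ := by rw [Finset.mul_sum]
    _ ≤ t ^ 4 * K := mul_le_mul_of_nonneg_left (sum_norm_Pn_neg_le hη hc l a N) (by positivity)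
    _ = K * t ^ 4 := mul_comm _ _

end Pn

/-! ## §4 (1.86) and (1.87) on the lattice `ℤ^d` (the carriers `covDeriv` = `D^{η*}_μ`, `conjR` = `R(·)` of the parents) -/

section Lattice

variable {𝔸 : Type*} [NormedRing 𝔸] [NormedAlgebra ℂ 𝔸]

/-- THE TRANSPORTED VALUE: `R(U₀(x, x − ηe_μ))F(x − ηe_μ) = η(D*_μF)(x) + F(x)` (`η ≠ 0`) — used in (1.86) for `F = λ`
(«ad_{R(U₀(x,x−ηe_μ))λ(x−ηe_μ)} = η ad_{(D*_μλ)(x)} + ad_{λ(x)}») and for `F = A_μ`.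
[cite: Balaban1985RegularSpaces, (1.1) p.76, (1.86) p.91] -/
theorem conjR_shift_eq {η : ℝ} (hη : η ≠ 0) (U₀ : Site d → Fin d → 𝔸ˣ) (μ : Fin d) (F : Site d → 𝔸)
    (x : Site d) : conjR (U₀ (x - e μ) μ)⁻¹ (F (x - e μ)) = η • covDeriv η U₀ μ F x + F x := by
  rw [eta_smul_covDeriv hη, sub_add_cancel]

/-- **(1.86), FIRST EQUALITY** (the definition (1.1) of `D^{η*}_μ`):
`ηD*_μ(ad_{λ(x)})ⁿA_μ(x) = R(U₀(x, x − ηe_μ))(ad_{λ(x−ηe_μ)})ⁿA_μ(x − ηe_μ) − (ad_{λ(x)})ⁿA_μ(x)` (`η ≠ 0`; `F` for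
`A_μ`). [cite: Balaban1985RegularSpaces, (1.86) p.91] -/
theorem eq186_first {η : ℝ} (hη : η ≠ 0) (U₀ : Site d → Fin d → 𝔸ˣ) (μ : Fin d) (lam F : Site d → 𝔸) (n : ℕ)
    (x : Site d) :
    η • covDeriv η U₀ μ (fun y => adPow (lam y) n (F y)) x
      = conjR (U₀ (x - e μ) μ)⁻¹ (adPow (lam (x - e μ)) n (F (x - e μ))) - adPow (lam x) n (F x) :=
  eta_smul_covDeriv hη U₀ μ _ x

/-- **(1.86), SECOND EQUALITY** (`R(U)` is an automorphism):
`… = (ad_{R(U₀(x,x−ηe_μ))λ(x−ηe_μ)})ⁿR(U₀(x, x − ηe_μ))A_μ(x − ηe_μ) − (ad_{λ(x)})ⁿA_μ(x)`.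
[cite: Balaban1985RegularSpaces, (1.86) p.91] -/
theorem eq186_second {η : ℝ} (hη : η ≠ 0) (U₀ : Site d → Fin d → 𝔸ˣ) (μ : Fin d) (lam F : Site d → 𝔸) (n : ℕ)
    (x : Site d) :
    η • covDeriv η U₀ μ (fun y => adPow (lam y) n (F y)) x
      = adPow (conjR (U₀ (x - e μ) μ)⁻¹ (lam (x - e μ))) n (conjR (U₀ (x - e μ) μ)⁻¹ (F (x - e μ)))
        - adPow (lam x) n (F x) := by
  rw [eq186_first hη, conjR_adPow]

/-- **(1.86), THIRD EQUALITY** (transport of the subscript and of the argument, (1.1)):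
`… = (η ad_{(D*_μλ)(x)} + ad_{λ(x)})ⁿ(η(D*_μA_μ)(x) + A_μ(x)) − (ad_{λ(x)})ⁿA_μ(x)`, the operator sum iterated `n` times
literally. [cite: Balaban1985RegularSpaces, (1.86) p.91] -/
theorem eq186_third {η : ℝ} (hη : η ≠ 0) (U₀ : Site d → Fin d → 𝔸ˣ) (μ : Fin d) (lam F : Site d → 𝔸) (n : ℕ)
    (x : Site d) :
    η • covDeriv η U₀ μ (fun y => adPow (lam y) n (F y)) x
      = (fun Z => η • adR (covDeriv η U₀ μ lam x) Z + adR (lam x) Z)^[n] (η • covDeriv η U₀ μ F x + F x)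
        - adPow (lam x) n (F x) := by
  rw [eq186_second hη, conjR_shift_eq hη, conjR_shift_eq hη, iterate_eta_adR_add_adR]

/-- **(1.86)** AS PRINTED — the chain of the three displayed equalities.
[cite: Balaban1985RegularSpaces, (1.86) p.91] -/
theorem eq186 {η : ℝ} (hη : η ≠ 0) (U₀ : Site d → Fin d → 𝔸ˣ) (μ : Fin d) (lam F : Site d → 𝔸) (n : ℕ)
    (x : Site d) :
    η • covDeriv η U₀ μ (fun y => adPow (lam y) n (F y)) x
        = conjR (U₀ (x - e μ) μ)⁻¹ (adPow (lam (x - e μ)) n (F (x - e μ))) - adPow (lam x) n (F x)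
      ∧ conjR (U₀ (x - e μ) μ)⁻¹ (adPow (lam (x - e μ)) n (F (x - e μ))) - adPow (lam x) n (F x)
        = adPow (conjR (U₀ (x - e μ) μ)⁻¹ (lam (x - e μ))) n (conjR (U₀ (x - e μ) μ)⁻¹ (F (x - e μ)))
          - adPow (lam x) n (F x)
      ∧ adPow (conjR (U₀ (x - e μ) μ)⁻¹ (lam (x - e μ))) n (conjR (U₀ (x - e μ) μ)⁻¹ (F (x - e μ)))
          - adPow (lam x) n (F x)
        = (fun Z => η • adR (covDeriv η U₀ μ lam x) Z + adR (lam x) Z)^[n] (η • covDeriv η U₀ μ F x + F x)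
          - adPow (lam x) n (F x) :=
  ⟨eq186_first hη U₀ μ lam F n x, (eq186_first hη U₀ μ lam F n x).symm.trans (eq186_second hη U₀ μ lam F n x),
    (eq186_second hη U₀ μ lam F n x).symm.trans (eq186_third hη U₀ μ lam F n x)⟩

/-- **(1.87)** («hence»): `D*_μ(ad_{λ(x)})ⁿA_μ(x) = (ad_{λ(x)})ⁿ(D*_μA_μ)(x) + P_n(λ(x), D*_μλ(x), A_μ(x), A_μ(x − ηe_μ))`
with OUR explicit `P_n` (`Pn`) evaluated at `l = λ(x)`, `a = (D*_μλ)(x)`, `Y = R(U₀(x, x − ηe_μ))A_μ(x − ηe_μ)`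
(`η ≠ 0`; exact in every normed `ℂ`-algebra, for every `U₀`). [cite: Balaban1985RegularSpaces, (1.87) p.91] -/
theorem eq187 {η : ℝ} (hη : η ≠ 0) (U₀ : Site d → Fin d → 𝔸ˣ) (μ : Fin d) (lam F : Site d → 𝔸) (n : ℕ)
    (x : Site d) :
    covDeriv η U₀ μ (fun y => adPow (lam y) n (F y)) x
      = adPow (lam x) n (covDeriv η U₀ μ F x)
        + Pn η (lam x) (covDeriv η U₀ μ lam x) (conjR (U₀ (x - e μ) μ)⁻¹ (F (x - e μ))) n := by
  have h2 := eq186_second hη U₀ μ lam F n x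
  rw [conjR_shift_eq hη U₀ μ lam x] at h2
  have hY := conjR_shift_eq hη U₀ μ F x
  have hsplit : adPow (lam x) n (conjR (U₀ (x - e μ) μ)⁻¹ (F (x - e μ)))
      = adPow (lam x) n (η • covDeriv η U₀ μ F x) + adPow (lam x) n (F x) := by
    rw [hY, adPow_add]
  have key : η • covDeriv η U₀ μ (fun y => adPow (lam y) n (F y)) x
      = η • (adPow (lam x) n (covDeriv η U₀ μ F x)
        + Pn η (lam x) (covDeriv η U₀ μ lam x) (conjR (U₀ (x - e μ) μ)⁻¹ (F (x - e μ))) n) := by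
    rw [h2, smul_add, eta_smul_Pn hη, ← adPow_smul_right, hsplit]
    abel
  calc covDeriv η U₀ μ (fun y => adPow (lam y) n (F y)) x
      = η⁻¹ • (η • covDeriv η U₀ μ (fun y => adPow (lam y) n (F y)) x) := by
        rw [smul_smul, inv_mul_cancel₀ hη, one_smul]
    _ = _ := by rw [key, smul_smul, inv_mul_cancel₀ hη, one_smul]

/-- (1.87) with the transported value written out: `Y = η(D*_μA_μ)(x) + A_μ(x)` — so `P_n` is a polynomial in
`λ(x)`, `D*_μλ(x)`, `(D*_μA_μ)(x)`, `A_μ(x)`. [cite: Balaban1985RegularSpaces, (1.87) p.91] -/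
theorem eq187' {η : ℝ} (hη : η ≠ 0) (U₀ : Site d → Fin d → 𝔸ˣ) (μ : Fin d) (lam F : Site d → 𝔸) (n : ℕ)
    (x : Site d) :
    covDeriv η U₀ μ (fun y => adPow (lam y) n (F y)) x
      = adPow (lam x) n (covDeriv η U₀ μ F x)
        + Pn η (lam x) (covDeriv η U₀ μ lam x) (η • covDeriv η U₀ μ F x + F x) n := by
  rw [eq187 hη, conjR_shift_eq hη]

/-- (1.87) AT `n = 1` — THE LATTICE LEIBNIZ RULE: `D*_μ[λ, A_μ](x) = [λ(x), (D*_μA_μ)(x)] + [(D*_μλ)(x),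
R(U₀(x, x − ηe_μ))A_μ(x − ηe_μ)]` (`η ≠ 0`). [cite: Balaban1985RegularSpaces, (1.87) p.91] -/
theorem covDeriv_adR {η : ℝ} (hη : η ≠ 0) (U₀ : Site d → Fin d → 𝔸ˣ) (μ : Fin d) (lam F : Site d → 𝔸)
    (x : Site d) :
    covDeriv η U₀ μ (fun y => adR (lam y) (F y)) x
      = adR (lam x) (covDeriv η U₀ μ F x)
        + adR (covDeriv η U₀ μ lam x) (conjR (U₀ (x - e μ) μ)⁻¹ (F (x - e μ))) := by
  have h := eq187 hη U₀ μ lam F 1 x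
  simpa only [adPow_one, Pn_one hη] using h

/-- (1.87) SUMMED OVER THE DIRECTIONS — the bookkeeping from (1.87) to (1.88), READING print's `D*` on bond functions
as `(D*A)(x) = Σ_μ(D*_μA_μ)(x)` [this reading is OURS: (1.1)–(1.2) display `D^{η*}_{U,μ}` and the divergence of
plaquette functions only]: `Σ_μD*_μ(ad_λ)ⁿA_μ(x) = (ad_{λ(x)})ⁿ(Σ_μD*_μA_μ)(x) + Σ_μP_n(λ(x), D*_μλ(x), ·)`.
[cite: Balaban1985RegularSpaces, (1.87)-(1.88) p.91] -/
theorem eq187_div {η : ℝ} (hη : η ≠ 0) (U₀ : Site d → Fin d → 𝔸ˣ) (lam : Site d → 𝔸) (A : Site d → Fin d → 𝔸)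
    (n : ℕ) (x : Site d) :
    ∑ μ, covDeriv η U₀ μ (fun y => adPow (lam y) n (A y μ)) x
      = adPow (lam x) n (∑ μ, covDeriv η U₀ μ (fun y => A y μ) x)
        + ∑ μ, Pn η (lam x) (covDeriv η U₀ μ lam x) (conjR (U₀ (x - e μ) μ)⁻¹ (A (x - e μ) μ)) n := by
  rw [adPow_sum, ← Finset.sum_add_distrib]
  exact Finset.sum_congr rfl fun μ _ => eq187 hη U₀ μ lam (fun y => A y μ) n x

/-- `D*_μ` of a finite `ℂ`-combination. [folklore] -/
theorem covDeriv_sum_smul (η : ℝ) (U₀ : Site d → Fin d → 𝔸ˣ) (μ : Fin d) (s : Finset ℕ) (c : ℕ → ℂ)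
    (G : ℕ → Site d → 𝔸) (x : Site d) :
    covDeriv η U₀ μ (fun y => ∑ n ∈ s, c n • G n y) x = ∑ n ∈ s, c n • covDeriv η U₀ μ (G n) x := by
  simp only [covDeriv, conjR_sum, conjR_smul, ← Finset.sum_sub_distrib, ← smul_sub, Finset.smul_sum]
  exact Finset.sum_congr rfl fun n _ => smul_comm _ _ _

/-- **(1.87) SUMMED AGAINST COEFFICIENTS** — «The operators R(u′⁻¹(b₋)) = e^{−i ad_{λ(b₋)}} and g(i ad_{λ(b₋)}) are
given by power series in ad_{λ(b₋)}» (p. 90): for every finite truncation `Σ_{n∈s}c_n(ad_λ)ⁿ`,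
`D*_μ[Σc_n(ad_{λ})ⁿF](x) = Σc_n(ad_{λ(x)})ⁿ(D*_μF)(x) + Σc_nP_n`. [cite: Balaban1985RegularSpaces, (1.87)-(1.88) p.91] -/
theorem eq187_sum {η : ℝ} (hη : η ≠ 0) (U₀ : Site d → Fin d → 𝔸ˣ) (μ : Fin d) (lam F : Site d → 𝔸)
    (x : Site d) (s : Finset ℕ) (c : ℕ → ℂ) :
    covDeriv η U₀ μ (fun y => ∑ n ∈ s, c n • adPow (lam y) n (F y)) x
      = ∑ n ∈ s, c n • adPow (lam x) n (covDeriv η U₀ μ F x)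
        + ∑ n ∈ s, c n • Pn η (lam x) (covDeriv η U₀ μ lam x) (conjR (U₀ (x - e μ) μ)⁻¹ (F (x - e μ))) n := by
  rw [covDeriv_sum_smul, ← Finset.sum_add_distrib]
  exact Finset.sum_congr rfl fun n _ => by rw [eq187 hη, smul_add]

/-! ### The `g(i ad_λ)(Dλ)` term: `F = D_μλ` — cell objection G-B8-11(b) -/

/-- THE TRANSPORT IDENTITY of the parent, rearranged: `R(U₀(x, x − ηe_μ))(D_μλ)(x − ηe_μ) = −(D*_μλ)(x)` — for
`F = D_μλ` the transported value `Y` of (1.87) is `−a`, `a = (D*_μλ)(x)`.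
[cite: Balaban1985RegularSpaces, (1.1) p.76; p.85 (line after (1.52))] -/
theorem conjR_covDerivFwd_shift (η : ℝ) (U₀ : Site d → Fin d → 𝔸ˣ) (μ : Fin d) (lam : Site d → 𝔸) (x : Site d) :
    conjR (U₀ (x - e μ) μ)⁻¹ (covDerivFwd η U₀ μ lam (x - e μ)) = -covDeriv η U₀ μ lam x := by
  rw [covDeriv_eq_neg_conjR_covDerivFwd, neg_neg]

/-- (1.87) FOR `F = D_μλ`: `D*_μ(ad_{λ(x)})ⁿ(D_μλ)(x) = (ad_{λ(x)})ⁿ(D*_μD_μλ)(x) + P_n(λ(x), a, −a)`, `a = (D*_μλ)(x)`.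
[cite: Balaban1985RegularSpaces, (1.87)-(1.88) p.91] -/
theorem eq187_covDerivFwd {η : ℝ} (hη : η ≠ 0) (U₀ : Site d → Fin d → 𝔸ˣ) (μ : Fin d) (lam : Site d → 𝔸)
    (n : ℕ) (x : Site d) :
    covDeriv η U₀ μ (fun y => adPow (lam y) n (covDerivFwd η U₀ μ lam y)) x
      = adPow (lam x) n (covDeriv η U₀ μ (covDerivFwd η U₀ μ lam) x)
        + Pn η (lam x) (covDeriv η U₀ μ lam x) (-covDeriv η U₀ μ lam x) n := by
  rw [eq187 hη, conjR_covDerivFwd_shift]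

/-- **G-B8-11(b), FIRST ORDER CANCELS EXACTLY**: `D*_μ[λ, D_μλ](x) = [λ(x), (D*_μD_μλ)(x)]` — no remainder at all,
for every `U₀`, every `λ`, every `η ≠ 0`, in every normed `ℂ`-algebra. [NOT print — ours]
[cite: Balaban1985RegularSpaces, (1.87) p.91] -/
theorem covDeriv_adR_covDerivFwd {η : ℝ} (hη : η ≠ 0) (U₀ : Site d → Fin d → 𝔸ˣ) (μ : Fin d) (lam : Site d → 𝔸)
    (x : Site d) :
    covDeriv η U₀ μ (fun y => adR (lam y) (covDerivFwd η U₀ μ lam y)) x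
      = adR (lam x) (covDeriv η U₀ μ (covDerivFwd η U₀ μ lam) x) := by
  have h := eq187_covDerivFwd hη U₀ μ lam 1 x
  simpa only [adPow_one, Pn_neg_one, add_zero] using h

/-- **G-B8-11(b), SECOND ORDER DOES NOT**: `D*_μ(ad_{λ})²(D_μλ)(x) = (ad_{λ(x)})²(D*_μD_μλ)(x) + [a, [a, λ(x)]]`,
`a = (D*_μλ)(x)` — an `A`-FREE term, quadratic in `D*λ`. [NOT print — ours]
[cite: Balaban1985RegularSpaces, (1.87) p.91] -/
theorem covDeriv_adPow_two_covDerivFwd {η : ℝ} (hη : η ≠ 0) (U₀ : Site d → Fin d → 𝔸ˣ) (μ : Fin d)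
    (lam : Site d → 𝔸) (x : Site d) :
    covDeriv η U₀ μ (fun y => adPow (lam y) 2 (covDerivFwd η U₀ μ lam y)) x
      = adPow (lam x) 2 (covDeriv η U₀ μ (covDerivFwd η U₀ μ lam) x)
        + adR (covDeriv η U₀ μ lam x) (adR (covDeriv η U₀ μ lam x) (lam x)) := by
  rw [eq187_covDerivFwd hη, Pn_neg_two hη]

/-- THE `F = D_μλ` BOUND ON THE LATTICE (`η > 0`): `|P_{n+1}(λ(x), a, −a)| ≤ 4n|λ(x)||a|²(2η|a| + 2|λ(x)|)ⁿ⁻¹`,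
`a = (D*_μλ)(x)` — no hypothesis on `U₀`. [NOT print — ours] [cite: Balaban1985RegularSpaces, (1.87)-(1.89) p.91] -/
theorem norm_Pn_covDerivFwd_le {η : ℝ} (hη : 0 < η) (U₀ : Site d → Fin d → 𝔸ˣ) (μ : Fin d) (lam : Site d → 𝔸)
    (n : ℕ) (x : Site d) :
    ‖Pn η (lam x) (covDeriv η U₀ μ lam x) (-covDeriv η U₀ μ lam x) (n + 1)‖
      ≤ 4 * n * ‖lam x‖ * ‖covDeriv η U₀ μ lam x‖ ^ 2
        * (2 * (η * ‖covDeriv η U₀ μ lam x‖) + 2 * ‖lam x‖) ^ (n - 1) := by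
  simpa only [abs_of_pos hη] using norm_Pn_neg_le hη.ne' (lam x) (covDeriv η U₀ μ lam x) n

variable [NormOneClass 𝔸]

/-- **THE BOUND ON `P_n` ON THE LATTICE** (`η > 0`, `U₀(x − ηe_μ, x) ∈ U1 ⊇ U(N)`, so `|Y| = |A_μ(x − ηe_μ)|`):
`|P_n| ≤ 2n|D*_μλ(x)|(2η|D*_μλ(x)| + 2|λ(x)|)ⁿ⁻¹|A_μ(x − ηe_μ)|` — first order in `D*λ` times `|A|`, the shape
«|𝔉₃| ≦ O(1)|Dλ||A|» of (1.89) for the `e^{−i ad_λ}A` part. [NOT print — ours]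
[cite: Balaban1985RegularSpaces, (1.87)-(1.89) p.91] -/
theorem norm_Pn_lattice_le {η : ℝ} (hη : 0 < η) {U₀ : Site d → Fin d → 𝔸ˣ} {μ : Fin d} {x : Site d}
    (h₀ : U₀ (x - e μ) μ ∈ U1 𝔸) (lam F : Site d → 𝔸) (n : ℕ) :
    ‖Pn η (lam x) (covDeriv η U₀ μ lam x) (conjR (U₀ (x - e μ) μ)⁻¹ (F (x - e μ))) n‖
      ≤ 2 * n * ‖covDeriv η U₀ μ lam x‖ * (2 * (η * ‖covDeriv η U₀ μ lam x‖) + 2 * ‖lam x‖) ^ (n - 1)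
        * ‖F (x - e μ)‖ := by
  have h := norm_Pn_le hη.ne' (lam x) (covDeriv η U₀ μ lam x) (conjR (U₀ (x - e μ) μ)⁻¹ (F (x - e μ))) n
  rwa [abs_of_pos hη, norm_conjR ((U1 𝔸).inv_mem h₀)] at h

/-- THE SUMMED BOUND ON THE LATTICE (`|c_n| ≤ 1/n!`, `η > 0`, `U₀(x − ηe_μ, x) ∈ U1`):
`|Σ_{n<N}c_nP_n| ≤ 2|D*_μλ(x)|e^{2η|D*_μλ(x)| + 2|λ(x)|}|A_μ(x − ηe_μ)|`, uniformly in `N`.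
[NOT print — ours]
[cite: Balaban1985RegularSpaces, (1.88)-(1.89) p.91] -/
theorem norm_sum_Pn_lattice_le {η : ℝ} (hη : 0 < η) {U₀ : Site d → Fin d → 𝔸ˣ} {μ : Fin d} {x : Site d}
    (h₀ : U₀ (x - e μ) μ ∈ U1 𝔸) {c : ℕ → ℂ} (hc : ∀ n, ‖c n‖ ≤ 1 / n !) (lam F : Site d → 𝔸) (N : ℕ) :
    ‖∑ n ∈ range N, c n • Pn η (lam x) (covDeriv η U₀ μ lam x) (conjR (U₀ (x - e μ) μ)⁻¹ (F (x - e μ))) n‖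
      ≤ 2 * ‖covDeriv η U₀ μ lam x‖ * Real.exp (2 * (η * ‖covDeriv η U₀ μ lam x‖) + 2 * ‖lam x‖)
        * ‖F (x - e μ)‖ := by
  have h := norm_sum_Pn_le hη.ne' hc (lam x) (covDeriv η U₀ μ lam x) (conjR (U₀ (x - e μ) μ)⁻¹ (F (x - e μ))) N
  rwa [abs_of_pos hη, norm_conjR ((U1 𝔸).inv_mem h₀)] at h

end Lattice

/-! ## §5 THE WITNESS: `M₂(ℂ)` with the operator norm, `d = 1`, `U₀ ≡ 1`, `η = 1`, `λ(x) = σ₃ + x·σ₁` -/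

section Witness

open scoped Matrix.Norms.L2Operator

/-- Pauli `σ₁`. [folklore] -/
def σ₁ : Matrix (Fin 2) (Fin 2) ℂ := !![0, 1; 1, 0]

/-- Pauli `σ₃`. [folklore] -/
def σ₃ : Matrix (Fin 2) (Fin 2) ℂ := !![1, 0; 0, -1]

/-- `[σ₁, [σ₁, σ₃]] = 4σ₃`. [folklore] -/
theorem adR_σ₁_adR_σ₁_σ₃ : adR σ₁ (adR σ₁ σ₃) = (4 : ℂ) • σ₃ := by
  ext i j
  fin_cases i <;> fin_cases j <;> simp [adR, σ₁, σ₃] <;> norm_num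

/-- `[σ₁, [σ₁, σ₃]] ≠ 0`. [folklore] -/
theorem adR_σ₁_adR_σ₁_σ₃_ne_zero : adR σ₁ (adR σ₁ σ₃) ≠ 0 := by
  rw [adR_σ₁_adR_σ₁_σ₃]
  intro h
  have := congr_fun (congr_fun h 0) 0
  simp [σ₃] at this

/-- The witness gauge parameter `λ(x) = σ₃ + x·σ₁` on `ℤ¹` (Hermitian-valued). [NOT print — ours]
[cite: Balaban1985RegularSpaces, (1.88)-(1.89) p.91] -/
def lamW : Site 1 → Matrix (Fin 2) (Fin 2) ℂ := fun x => σ₃ + ((x 0 : ℤ) : ℂ) • σ₁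

/-- The witness background `U₀ ≡ 1`. [NOT print — ours] [cite: Balaban1985RegularSpaces, (1.88)-(1.89) p.91] -/
def U₀W : Site 1 → Fin 1 → (Matrix (Fin 2) (Fin 2) ℂ)ˣ := fun _ _ => 1

/-- `(D*_0λ)(x) = −σ₁` for the witness (`η = 1`). [NOT print — ours]
[cite: Balaban1985RegularSpaces, (1.1) p.76, (1.88)-(1.89) p.91] -/
theorem covDeriv_lamW (x : Site 1) : covDeriv 1 U₀W 0 lamW x = -σ₁ := by
  have hx : (x - e (0 : Fin 1)) (0 : Fin 1) = x 0 - 1 := by simp [e]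
  simp only [covDeriv, U₀W, inv_one, one_conjR, lamW, one_smul, hx, Int.cast_sub, Int.cast_one, sub_smul]
  abel

/-- THE WITNESS VALUE OF THE SECOND-ORDER TERM: `P_2(λ(x), a, −a) = [a, [a, λ(x)]] = 4σ₃`, `a = (D*_0λ)(x) = −σ₁`.
[NOT print — ours] [cite: Balaban1985RegularSpaces, (1.87)-(1.89) p.91] -/
theorem Pn_two_witness (x : Site 1) :
    Pn 1 (lamW x) (covDeriv 1 U₀W 0 lamW x) (-covDeriv 1 U₀W 0 lamW x) 2 = (4 : ℂ) • σ₃ := by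
  rw [Pn_neg_two one_ne_zero, covDeriv_lamW, adR_neg_left, adR_neg_left, adR_neg_right, neg_neg]
  have : adR σ₁ (lamW x) = adR σ₁ σ₃ := by
    rw [lamW, adR_add_right, adR_smul_right, adR_self, smul_zero, add_zero]
  rw [this, adR_σ₁_adR_σ₁_σ₃]

/-- **G-B8-11(b) ON A LATTICE CONFIGURATION**: for `d = 1`, `U₀ ≡ 1`, `η = 1`, `λ(x) = σ₃ + xσ₁`,
`D*_0(ad_λ)²(D_0λ)(x) − (ad_{λ(x)})²(D*_0D_0λ)(x) = 4σ₃ ≠ 0`: the commutator `[D*, (ad_λ)²]D_0λ` has a non-zero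
`A`-free value. [NOT print — ours] [cite: Balaban1985RegularSpaces, (1.87)-(1.89) p.91] -/
theorem witness_second_order (x : Site 1) :
    covDeriv 1 U₀W 0 (fun y => adPow (lamW y) 2 (covDerivFwd 1 U₀W 0 lamW y)) x
      - adPow (lamW x) 2 (covDeriv 1 U₀W 0 (covDerivFwd 1 U₀W 0 lamW) x) = (4 : ℂ) • σ₃ := by
  rw [eq187_covDerivFwd one_ne_zero, add_sub_cancel_left, Pn_two_witness]

/-- … and `4σ₃ ≠ 0`. [NOT print — ours] [cite: Balaban1985RegularSpaces, (1.88)-(1.89) p.91] -/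
theorem witness_second_order_ne_zero (x : Site 1) :
    covDeriv 1 U₀W 0 (fun y => adPow (lamW y) 2 (covDerivFwd 1 U₀W 0 lamW y)) x
      - adPow (lamW x) 2 (covDeriv 1 U₀W 0 (covDerivFwd 1 U₀W 0 lamW) x) ≠ 0 := by
  rw [witness_second_order, ← adR_σ₁_adR_σ₁_σ₃]
  exact adR_σ₁_adR_σ₁_σ₃_ne_zero

/-- `D*` is real-homogeneous: `D*_μ(tλ) = tD*_μλ`. [folklore] -/
theorem covDeriv_smul_real {𝔹 : Type*} [NormedRing 𝔹] [NormedAlgebra ℂ 𝔹] (η : ℝ) (V : Site d → Fin d → 𝔹ˣ)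
    (ν : Fin d) (t : ℝ) (F : Site d → 𝔹) (x : Site d) : covDeriv η V ν (t • F) x = t • covDeriv η V ν F x := by
  rw [← Complex.coe_smul, covDeriv_smul, Complex.coe_smul]

/-- **THE FULL SECOND-ORDER OBJECTION, KERNEL FORM** (upgrading the cell numerics N-B8-3 (3c)/(3d)): for EVERY
coefficient sequence with `|c_n| ≤ 1/n!` and `c_2 ≠ 0` (for print's `g(i ad_λ)`: `c_n = iⁿ(−1)ⁿ/(n + 1)!`,
`c_2 = −1/6`) there is `t₀ > 0` such that for all `0 < t < t₀` and EVERY truncation order `N ≥ 3`, on the scaled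
witness `λ_t = t(σ₃ + xσ₁)`, `U₀ ≡ 1`, `η = 1`, at the site `x = 0`:
`D*_0[Σ_{n<N}c_n(ad_{λ_t})ⁿD_0λ_t](0) − Σ_{n<N}c_n(ad_{λ_t(0)})ⁿ(D*_0D_0λ_t)(0) ≠ 0` — the `A`-free part of the
remainder `𝔉₃` of (1.88) does not vanish, so it is not `≦ O(1)|Dλ||A|` as (1.89) prints (that bound is `0` at
`A = 0`). [NOT print — ours] [cite: Balaban1985RegularSpaces, (1.88)-(1.89) p.91] -/
theorem G_B8_11b_witness {c : ℕ → ℂ} (hc : ∀ n, ‖c n‖ ≤ 1 / n !) (hc2 : c 2 ≠ 0) :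
    ∃ t₀ : ℝ, 0 < t₀ ∧ ∀ t : ℝ, 0 < t → t < t₀ → ∀ N : ℕ, 3 ≤ N →
      covDeriv 1 U₀W 0 (fun y => ∑ n ∈ range N, c n • adPow ((t • lamW) y) n (covDerivFwd 1 U₀W 0 (t • lamW) y)) 0
        - ∑ n ∈ range N, c n • adPow ((t • lamW) 0) n (covDeriv 1 U₀W 0 (covDerivFwd 1 U₀W 0 (t • lamW)) 0)
          ≠ 0 := by
  -- the data of the abstract statement: `l = λ(0) = σ₃`, `a = (D*_0λ)(0) = −σ₁`
  set K := 4 * ‖σ₃‖ * ‖-σ₁‖ ^ 2 * Real.exp (2 * (|(1 : ℝ)| * ‖-σ₁‖) + 2 * ‖σ₃‖) with hK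
  have hK0 : 0 ≤ K := by positivity
  have hv : 0 < ‖c 2‖ * ‖adR (-σ₁) (adR (-σ₁) σ₃)‖ := by
    rw [adR_neg_left, adR_neg_left, adR_neg_right, neg_neg]
    exact mul_pos (norm_pos_iff.2 hc2) (norm_pos_iff.2 adR_σ₁_adR_σ₁_σ₃_ne_zero)
  refine ⟨min 1 (‖c 2‖ * ‖adR (-σ₁) (adR (-σ₁) σ₃)‖ / (K + 1)), lt_min one_pos (div_pos hv (by linarith)), ?_⟩
  intro t ht0 ht N hN
  have ht1 : t ≤ 1 := (ht.trans_le (min_le_left _ _)).le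
  have htK : K * t < ‖c 2‖ * ‖adR (-σ₁) (adR (-σ₁) σ₃)‖ := by
    have h1 : t < ‖c 2‖ * ‖adR (-σ₁) (adR (-σ₁) σ₃)‖ / (K + 1) := ht.trans_le (min_le_right _ _)
    have h2 : K * t ≤ (K + 1) * t := by nlinarith
    calc K * t ≤ (K + 1) * t := h2
      _ < (K + 1) * (‖c 2‖ * ‖adR (-σ₁) (adR (-σ₁) σ₃)‖ / (K + 1)) := by gcongr
      _ = ‖c 2‖ * ‖adR (-σ₁) (adR (-σ₁) σ₃)‖ := by field_simp
  have hl0 : (t • lamW) 0 = t • σ₃ := by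
    simp [lamW]
  have ha0 : covDeriv 1 U₀W 0 (t • lamW) 0 = t • (-σ₁) := by
    rw [covDeriv_smul_real, covDeriv_lamW]
  rw [eq187_sum one_ne_zero, add_sub_cancel_left]
  simp_rw [conjR_covDerivFwd_shift, ha0, hl0]
  exact truncated_remainder_ne_zero one_ne_zero hc σ₃ (-σ₁) ht0 ht1 htK hN

end Witness

end Literature.MathematicalPhysics.QuantumFieldTheory.Balaban1983to89.B8Eq186AdCommutator

end
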